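import Literature.IUT.LogVolume.Theorem110Data
import HarnessLib

/-!
# [IUTchIV] Thm 1.10 numerics: the schema `CThetaAdmissible` / `Cor312` is NOT a 0-ary fact

`Literature.IUT.LogVolume.Thm110Numerics` (abc-iut-S3, `Theorem110Data.lean`) is a PURE DATA record
("no relation between the fields is assumed beyond the printed signs/ranges"); in particular the field
`negLogTheta` (print: "`−|log(Θ)| ∈ ℝ`", [IUTchIII] Cor. 3.12) is a free real number.  Hence the
parametrised predicates `X.CThetaAdmissible` ("one may take `C_Θ` to be …", [IUTchIV] Thm 1.10 p. 23)
and `X.Cor312` (`−|log(q)| ≤ −|log(Θ)|`) hold at SOME records and fail at OTHERS: their universal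
closures are false in the kernel, so neither may be consumed as a frozen named fact of shape
`∀ X, X.CThetaAdmissible` / `∀ X, X.Cor312` (FACT-LIST rows F-2139 / F-2140) — only AT A NAMED
INSTANCE (the numerics of genuine initial Θ-data).  This file records the two-sided kernel witnesses.
HONEST FRAMING: bookkeeping about the typing; nothing here bears on the truth of [IUTchIII] Cor. 3.12.
-/

namespace Literature.IUT.LogVolume.Thm110Numerics

/-- A sample numerics record: `l = 5`, `d_mod = e_mod = 1`, `η_prm = 1`, all log-divisor degrees `0`,
`log(q) = 1`, and a prescribed value `t` for the free field `−|log(Θ)|`.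
[cite: Mochizuki2012, IUTchIV Thm 1.10 p.22] -/
noncomputable def sample (t : ℝ) : Thm110Numerics where
  l := 5
  prime_l := Nat.prime_five
  five_le_l := le_rfl
  dmod := 1
  one_le_dmod := le_rfl
  emod := 1
  one_le_emod := le_rfl
  emod_le_dmod := le_rfl
  etaPrm := 1
  etaPrm_pos := one_pos
  logDiffTpd := 0
  logDiffTpd_nonneg := le_rfl
  logCondTpd := 0
  logCondTpd_nonneg := le_rfl
  logDiffF := 0
  logDiffF_nonneg := le_rfl
  logCondF := 0
  logCondF_nonneg := le_rfl
  logq := 1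
  logq_pos := one_pos
  negLogTheta := t

/-- The free field of `sample t` is `t`. [cite: Mochizuki2012, IUTchIV Thm 1.10 p.22] -/
@[simp] theorem sample_negLogTheta (t : ℝ) : (sample t).negLogTheta = t := rfl

/-- `C_Θ` of `sample t` does not depend on `t` (it never reads `negLogTheta`).
[cite: Mochizuki2012, IUTchIV Thm 1.10 p.23] -/
theorem sample_CTheta (t : ℝ) : (sample t).CTheta = (sample 0).CTheta := rfl

/-- `|log(q)|` of `sample t` does not depend on `t`. [cite: Mochizuki2012, IUTchIV Thm 1.10 p.23] -/
theorem sample_absLogq (t : ℝ) : (sample t).absLogq = (sample 0).absLogq := rfl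

/-- `|log(q)| = 1/10 > 0` for the sample. [cite: Mochizuki2012, IUTchIV Thm 1.10 p.23] -/
theorem sample_absLogq_eq (t : ℝ) : (sample t).absLogq = 1 / 10 := by
  show (1 : ℝ) / (2 * ((5 : ℕ) : ℝ)) = 1 / 10
  norm_num

/-- **The universal closure of `CThetaAdmissible` is false**: at the record with
`−|log(Θ)| := C_Θ·|log(q)| + 1` the inequality `−|log(Θ)| ≤ C_Θ·|log(q)|` fails.  So FACT-LIST row
F-2139 can only be consumed at a named instance. [cite: Mochizuki2012, IUTchIV Thm 1.10 p.23] -/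
theorem not_forall_cThetaAdmissible : ¬ ∀ X : Thm110Numerics, X.CThetaAdmissible := by
  intro h
  set t : ℝ := (sample 0).CTheta * (sample 0).absLogq + 1
  have hX := h (sample t)
  unfold CThetaAdmissible at hX
  rw [sample_negLogTheta, sample_CTheta t, sample_absLogq t] at hX
  linarith

/-- … while it does hold at some record (`−|log(Θ)| := C_Θ·|log(q)|`), so the predicate is a genuine
two-sided schema, not a contradiction. [cite: Mochizuki2012, IUTchIV Thm 1.10 p.23] -/
theorem exists_cThetaAdmissible : ∃ X : Thm110Numerics, X.CThetaAdmissible := by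
  set t : ℝ := (sample 0).CTheta * (sample 0).absLogq
  refine ⟨sample t, ?_⟩
  unfold CThetaAdmissible
  rw [sample_negLogTheta, sample_CTheta t, sample_absLogq t]

/-- **The universal closure of the numerics-level `Cor312` is false**: at `−|log(Θ)| := −|log(q)| − 1`.
(Row F-2140 is already «NO — inside the cone»; recorded for completeness of the schema census.)
[cite: Mochizuki2012, IUTchIV Thm 1.10 p.23] -/
theorem not_forall_cor312 : ¬ ∀ X : Thm110Numerics, X.Cor312 := by
  intro h
  set t : ℝ := -(sample 0).absLogq - 1
  have hX := h (sample t)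
  unfold Cor312 at hX
  rw [sample_negLogTheta, sample_absLogq t] at hX
  linarith

/-- … and `Cor312` holds at some record (`−|log(Θ)| := 0 ≥ −1/10`).
[cite: Mochizuki2012, IUTchIV Thm 1.10 p.23] -/
theorem exists_cor312 : ∃ X : Thm110Numerics, X.Cor312 := by
  refine ⟨sample 0, ?_⟩
  unfold Cor312
  rw [sample_negLogTheta, sample_absLogq_eq]
  norm_num

end Literature.IUT.LogVolume.Thm110Numerics
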